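import Summits.BirchSwinnertonDyer.Rank1Residual.X11b.KolyvaginHeegnerTowerData
import Summits.BirchSwinnertonDyer.Rank1Residual.X11b.KolyvaginChoiceIndependence
import Summits.BirchSwinnertonDyer.Rank1Residual.X11b.KolyvaginRingClassCardinality
import Summits.BirchSwinnertonDyer.BirchSwinnertonDyer.Theorems.KolyvaginRoadThreeLevelData
import HarnessLib

/-!
# T1 JET (cell `bsd-jet`), road K: COMPATIBLE Kolyvagin–Heegner data at the conductor `cℓ` EXTENDING a
# given datum at `c` — the hypotheses `dℓ` / `hdata` of `JET.tamagawaExponent_le_mInfty_of_rowData`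
# (p492296) DISCHARGED modulo the CM fact `y(cℓ) ∈ E(K[cℓ])` (Gross 1991 §3)

HONEST FRAMING (programme file §HONESTY, verbatim): «no tranche here proves BSD; ARM L moves the
LITERAL column of an r ≤ 1 census into the kernel-proved-modulo-named-print column.» THEOREMS ONLY
(seat `bsd-jet-pv-2`, session g3; `--supports stmt-BirchSwinnertonDyer-14418`, helper); 0 classes
move. WHAT THIS IS. The typed McCallum Prop. 4.4 (`McCallum1991.prop44_localOrder_kolyvaginClass_mul_eq`,
p478965) and its road-K adapter `JET.addOrderOf_localization_kolyvaginClass_mul_eq_of_prop44` compare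
the classes of two Kolyvagin–Heegner data `d` (conductor `m`) and `d'` (conductor `mℓ`) that are
COMPATIBLE along `K[m] ⊆ K[mℓ]`: the generators `σ_{l'}` of `d'` restrict to those of `d` (`hσ`), the
transversals correspond (`hS`, `hS'`), the embeddings into `K̄` agree (`hemb`) — McCallum's / Gross's
ONE system of choices (*"Let `σ_ℓ` be a fixed generator of `G_ℓ` … Let `S` be a set of coset
representatives for `G_n` in `𝒢_n`"*, Gross §3–§4) read at two levels. The row theorem
`JET.tamagawaExponent_le_mInfty_of_rowData` takes such compatible data as the hypotheses `dℓ`, `hdata`.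
Here they are CONSTRUCTED: given ANY datum `d` of square-free conductor `c` (inert prime factors), a
prime `ℓ ∤ c` inert in `K`, and the CM input point `y(cℓ) ∈ E(K[cℓ])` over `φ(x(cℓ))` (the one field of
`KolyvaginHeegnerData` that is CM theory — the named fact
`phi_heegnerPointOfConductor_mem_range_map_ringClassField`, Gross 1991 §3, as in
`nonempty_kolyvaginHeegnerData_of_grossCM`), there is a datum `d'` of conductor `cℓ` compatible with `d`
in exactly the four clauses. Construction (x11b3's ring class tower, UNCONDITIONAL): restriction
`res : 𝒢_{cℓ} → 𝒢_c` and top-level generators `g_q` (`RingClassTower.exists_coherent_towerData`); for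
`q ∣ c` the given generator is `d.σ_q = res(g_q)^{a_q}` with `a_q` invertible mod `q + 1`
(`KolyvaginChoice.exists_pow_eq_of_zpowers_eq`), so `σ'_q := g_q^{a_q}` generates `G_q(cℓ)` and
restricts to `d.σ_q`; `σ'_ℓ := g_ℓ`; `S' :=` lifts of `d.S` along `res` (a transversal of `G_{cℓ}` in
`𝒢_{cℓ}` because `res` detects `Gal(·/K[1])`, `RingClassTower.mem_ringClassGalOver_of_restrictHom_mem` /
`restrictHom_mem_ringClassGalOver`); `emb' := IsAlgClosed.lift` of `d.emb` along `K[c] ⊆ K[cℓ]`.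
References: [cite: GrossLMS1991, §3 (pp. 238–239: G_n ≃ ∏ G_ℓ, σ_ℓ), §4 (4.1) (S)]
[cite: McCallumLMS1991, §4 (p. 300: σ_l, S, P_n), Prop. 4.4 (p. 301)]
[cite: Jetchev2008, §4.1 (p. 818), Prop. 4.4 (p. 821)].
-/

set_option autoImplicit false

noncomputable section

open scoped Classical

open WeierstrassCurve Field NumberField IsDedekindDomain
  Literature.NumberTheory.EllipticCurves Literature.NumberTheory.EllipticCurves.ModularForms
  Literature.NumberTheory.EllipticCurves.RingClassField
  Summit.BirchSwinnertonDyer.Rank1Residual.X11b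

namespace Summit.BirchSwinnertonDyer.Rank1Residual.JET

-- `K : Type`: the tree's ring-class class field theory is universe `0`.
variable {K : Type} [Field K] [NumberField K] {N : ℕ} [NeZero N] {W : WeierstrassCurve ℚ}

/-- A power `g^a` with `a` invertible modulo an exponent of `g` generates the same cyclic group as `g`.
[folklore] -/
theorem zpowers_pow_eq_of_mul_mod_eq_one {G : Type*} [Group G] {g : G} {q a b : ℕ}
    (hg : g ^ (q + 1) = 1) (hab : a * b % (q + 1) = 1) :
    Subgroup.zpowers (g ^ a) = Subgroup.zpowers g := by
  apply le_antisymm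
  · rw [Subgroup.zpowers_le]
    exact Subgroup.pow_mem (Subgroup.zpowers g) (Subgroup.mem_zpowers g) a
  rw [Subgroup.zpowers_le]
  have h : (g ^ a) ^ b = g := by
    rw [← pow_mul, ← Nat.mod_add_div (a * b) (q + 1), pow_add, pow_mul, hg, one_pow, mul_one, hab,
      pow_one]
  exact Subgroup.mem_zpowers_iff.mpr ⟨(b : ℤ), by rw [zpow_natCast, h]⟩

/-- **Compatible Kolyvagin–Heegner data at `cℓ` extending a datum at `c`** (Gross 1991 §3–§4 /
McCallum 1991 §4: one coherent system of choices `σ_l`, `S`, `K_n ⊂ K̄`, read at the levels `c` and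
`cℓ`). For `K` imaginary quadratic with `d_K < −4`, a frame `(Dt, β, ι)`, a square-free conductor `cℓ`
(`ℓ` prime, `ℓ ∤ c`) all of whose prime factors are inert in `K`, ANY datum `d` of conductor `c`, and a
point `y' ∈ E(K[cℓ])` over `φ(x(cℓ))` (the CM input; `ℓ` is any natural number with `cℓ` square-free —
in the application a Kolyvagin prime not dividing `c`), there is a datum `d'` of conductor `cℓ` with
`d'.y = y'` whose generators restrict to those of `d` at the primes of `c` (`hσ`), whose transversal
corresponds to `d.S` both ways (`hS`, `hS'`) and whose embedding `K[cℓ] → K̄` extends `d.emb` (`hemb`)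
— the compatibility hypotheses of `McCallum1991.prop44_localOrder_kolyvaginClass_mul_eq` /
`JET.addOrderOf_localization_kolyvaginClass_mul_eq_of_prop44`, hence the `dℓ`/`hdata` inputs of
`JET.tamagawaExponent_le_mInfty_of_rowData`. [cite: GrossLMS1991, §3 (pp. 238–239), §4 (4.1)]
[cite: McCallumLMS1991, §4 (p. 300), Prop. 4.4 (p. 301)] -/
theorem exists_compatible_datum_mul (hK : IsImaginaryQuadratic K) (hD : NumberField.discr K < -4)
    (ι : K →+* ℂ) (Dt : ModularParametrizationData W N) {β : ℤ}
    {c ℓ : ℕ} (hcl : Squarefree (c * ℓ))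
    (hinert : ∀ q ∈ (c * ℓ).primeFactors, (Ideal.span {(q : 𝓞 K)}).IsPrime)
    (d : KolyvaginHeegnerData Dt β ι c)
    (y' : (W.baseChange (ringClassField K ι (c * ℓ))).toAffine.Point)
    (hy' : WeierstrassCurve.Affine.Point.map (ringClassField K ι (c * ℓ)).subtype.toRatAlgHom y' =
      heegnerPointComplexOfConductor Dt (NumberField.discr K) β (c * ℓ)) :
    ∃ d' : KolyvaginHeegnerData Dt β ι (c * ℓ), d'.y = y' ∧
      (∀ l' ∈ c.primeFactors, ∀ (x : ringClassField K ι c) (x' : ringClassField K ι (c * ℓ)),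
        (x : ℂ) = x' → ((d'.σ l' x' : ringClassField K ι (c * ℓ)) : ℂ) = (d.σ l' x : ℂ)) ∧
      (∀ s ∈ d.S, ∃ s' ∈ d'.S, ∀ (x : ringClassField K ι c) (x' : ringClassField K ι (c * ℓ)),
        (x : ℂ) = x' → ((s' x' : ringClassField K ι (c * ℓ)) : ℂ) = (s x : ℂ)) ∧
      (∀ s' ∈ d'.S, ∃ s ∈ d.S, ∀ (x : ringClassField K ι c) (x' : ringClassField K ι (c * ℓ)),
        (x : ℂ) = x' → ((s' x' : ringClassField K ι (c * ℓ)) : ℂ) = (s x : ℂ)) ∧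
      (∀ (x : ringClassField K ι c) (x' : ringClassField K ι (c * ℓ)),
        (x : ℂ) = x' → d'.emb x' = d.emb x) := by
  -- elementary facts (`n = cℓ`)
  have hn0 : c * ℓ ≠ 0 := hcl.ne_zero
  have hc0 : c ≠ 0 := fun h ↦ hn0 (by rw [h, zero_mul])
  have hcn : c ∣ c * ℓ := Dvd.intro ℓ rfl
  have hcsq : Squarefree c := hcl.squarefree_of_dvd hcn
  have hle : ringClassField K ι c ≤ ringClassField K ι (c * ℓ) := ringClassField_mono hK ι hcn hn0
  have h1le : ringClassField K ι 1 ≤ ringClassField K ι c := ringClassField_mono hK ι (one_dvd c) hc0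
  -- x11b3's coherent tower at the top level `n = cℓ`: restriction homs and generators
  obtain ⟨res, g, -, h1, h2, h3, h4, -⟩ := RingClassTower.exists_coherent_towerData hK ι hcl hinert
  have hr := h1 c hcn
  -- (σ) for `q ∣ c`: `d.σ q = res (g q) ^ a q` with `a q` invertible mod `q + 1`
  have hpow : ∀ q ∈ c.primeFactors, ∃ a b : ℕ, d.σ q = (res c (g q)) ^ a ∧ a * b % (q + 1) = 1 := by
    intro q hq
    have hqp : q.Prime := Nat.prime_of_mem_primeFactors hq
    have hqc : q ∣ c := Nat.dvd_of_mem_primeFactors hq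
    have hqn : q ∈ (c * ℓ).primeFactors := Nat.primeFactors_mono hcn hn0 hq
    have hndvd : ¬ q ∣ c / q := fun h ↦ by
      have : q * q ∣ c := by
        have := Nat.mul_dvd_mul_left q h
        rwa [Nat.mul_div_cancel' hqc] at this
      exact hqp.one_lt.ne' (Nat.isUnit_iff.mp (hcsq q this))
    have hord : orderOf (res c (g q)) = q + 1 :=
      RingClassTower.orderOf_eq_succ_of_zpowers_eq_ringClassGalOver hK ι hqp (hinert q hqn) hqc hndvd
        hc0 (Or.inr hD) (h4 c hcn q hq).1
    exact KolyvaginChoice.exists_pow_eq_of_zpowers_eq hqp.ne_zero hord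
      ((d.zpowers_σ q hq).trans (h4 c hcn q hq).1.symm)
  choose! a b ha hab using hpow
  -- the generators at level `cℓ`
  let σ' : ℕ → (ringClassField K ι (c * ℓ) ≃ₐ[ℚ] ringClassField K ι (c * ℓ)) := fun q ↦
    if q ∈ c.primeFactors then (g q : ringClassField K ι (c * ℓ) ≃ₐ[ℚ] ringClassField K ι (c * ℓ)) ^ a q
    else (g q : ringClassField K ι (c * ℓ) ≃ₐ[ℚ] ringClassField K ι (c * ℓ))
  have hgtop : ∀ q ∈ (c * ℓ).primeFactors,
      Subgroup.zpowers (g q : ringClassField K ι (c * ℓ) ≃ₐ[ℚ] ringClassField K ι (c * ℓ)) =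
        ringClassGalOver ι (c * ℓ) (c * ℓ / q) ∧
      (g q : ringClassField K ι (c * ℓ) ≃ₐ[ℚ] ringClassField K ι (c * ℓ)) ^ (q + 1) = 1 := by
    intro q hq
    have h := h4 (c * ℓ) dvd_rfl q hq
    rw [h2 (g q)] at h
    exact h
  have hσ'z : ∀ q ∈ (c * ℓ).primeFactors, Subgroup.zpowers (σ' q) = ringClassGalOver ι (c * ℓ) (c * ℓ / q) := by
    intro q hq
    by_cases hqc : q ∈ c.primeFactors
    · simp only [σ', hqc, if_true]
      rw [zpowers_pow_eq_of_mul_mod_eq_one (hgtop q hq).2 (hab q hqc)]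
      exact (hgtop q hq).1
    · simp only [σ', hqc, if_false]
      exact (hgtop q hq).1
  -- (S) lifts of `d.S` along `res`
  have hliftex : ∀ s : ringClassField K ι c ≃ₐ[ℚ] ringClassField K ι c, ∃ t : ringClassGal ι (c * ℓ),
      s ∈ ringClassGal ι c → res c t = s := by
    intro s
    by_cases hs : s ∈ ringClassGal ι c
    · obtain ⟨t, ht⟩ := RingClassTower.exists_restrictHom_eq hK ι hcn hn0 hr hs
      exact ⟨t, fun _ ↦ ht⟩
    · exact ⟨1, fun h ↦ (hs h).elim⟩
  choose lift hlift using hliftex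
  let S' : Finset (ringClassField K ι (c * ℓ) ≃ₐ[ℚ] ringClassField K ι (c * ℓ)) :=
    d.S.image fun s ↦ (lift s : ringClassField K ι (c * ℓ) ≃ₐ[ℚ] ringClassField K ι (c * ℓ))
  -- (emb) extend `d.emb` along `K[c] ⊆ K[n]`
  letI algCn : Algebra (ringClassField K ι c) (ringClassField K ι (c * ℓ)) :=
    (RingClassField.inclusion ι hle).toRingHom.toAlgebra
  haveI : IsScalarTower K (ringClassField K ι c) (ringClassField K ι (c * ℓ)) :=
    IsScalarTower.of_algebraMap_eq fun k ↦ ((RingClassField.inclusion ι hle).commutes k).symm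
  letI algCA : Algebra (ringClassField K ι c) (AlgebraicClosure K) := d.emb.toAlgebra
  haveI := (finiteDimensional_and_isGalois_ringClassField hK ι hn0).1
  haveI : Algebra.IsAlgebraic K (ringClassField K ι (c * ℓ)) := Algebra.IsAlgebraic.of_finite K _
  haveI : Algebra.IsAlgebraic (ringClassField K ι c) (ringClassField K ι (c * ℓ)) :=
    Algebra.IsAlgebraic.tower_top (K := K) (ringClassField K ι c)
  let e : ringClassField K ι (c * ℓ) →ₐ[ringClassField K ι c] AlgebraicClosure K := IsAlgClosed.lift
  have he : ∀ x : ringClassField K ι c, e (RingClassField.inclusion ι hle x) = d.emb x := fun x ↦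
    e.commutes x
  have hincl : ∀ (x : ringClassField K ι c) (x' : ringClassField K ι (c * ℓ)), (x : ℂ) = x' →
      x' = RingClassField.inclusion ι hle x := fun x x' hxx' ↦
    Subtype.ext (by rw [RingClassField.coe_inclusion]; exact hxx'.symm)
  -- the datum
  refine ⟨{ dvd_sq_sub := d.dvd_sq_sub
            y := y'
            map_y := hy'
            σ := σ'
            zpowers_σ := hσ'z
            S := S'
            S_subset := ?_
            S_transversal := ?_
            emb := e.toRingHom
            emb_apply := ?_ }, rfl, ?_, ?_, ?_, ?_⟩
  · -- `S' ⊆ 𝒢_n`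
    intro s hs
    obtain ⟨s₀, -, rfl⟩ := Finset.mem_image.mp hs
    exact (lift s₀).2
  · -- `S'` is a transversal of `G_n = Gal(K[n]/K[1])` in `𝒢_n`
    intro G hG
    set Gg : ringClassGal ι (c * ℓ) := ⟨G, hG⟩ with hGg
    have hh : res c Gg ∈ ringClassGal ι c := h3 c hcn Gg
    obtain ⟨s, ⟨hsS, hs1⟩, huniq⟩ := d.S_transversal (res c Gg) hh
    have hsG : s ∈ ringClassGal ι c := d.S_subset s hsS
    have hres_s : res c (lift s) = s := hlift s hsG
    refine ⟨(lift s : ringClassField K ι (c * ℓ) ≃ₐ[ℚ] ringClassField K ι (c * ℓ)), ⟨?_, ?_⟩, ?_⟩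
    · exact Finset.mem_image.mpr ⟨s, hsS, rfl⟩
    · have hmem : res c (Gg⁻¹ * lift s) ∈ ringClassGalOver ι c 1 := by
        rw [map_mul, map_inv, hres_s]
        exact hs1
      have h := RingClassTower.mem_ringClassGalOver_of_restrictHom_mem ι hr h1le (Gg⁻¹ * lift s) hmem
      simpa [hGg] using h
    · rintro s'' ⟨hs''S, hs''1⟩
      obtain ⟨s₂, hs₂S, rfl⟩ := Finset.mem_image.mp hs''S
      have hs₂G : s₂ ∈ ringClassGal ι c := d.S_subset s₂ hs₂S
      have hmem : ((Gg⁻¹ * lift s₂ : ringClassGal ι (c * ℓ)) :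
          ringClassField K ι (c * ℓ) ≃ₐ[ℚ] ringClassField K ι (c * ℓ)) ∈ ringClassGalOver ι (c * ℓ) 1 := by
        simpa [hGg] using hs''1
      have h := RingClassTower.restrictHom_mem_ringClassGalOver hK ι hcn hn0 hr (Gg⁻¹ * lift s₂) hmem
      rw [map_mul, map_inv, hlift s₂ hs₂G] at h
      rw [huniq s₂ ⟨hs₂S, h⟩]
  · -- `emb'` is the identity on `K`
    intro k
    change e (algebraMap K (ringClassField K ι (c * ℓ)) k) = _
    rw [IsScalarTower.algebraMap_apply K (ringClassField K ι c) (ringClassField K ι (c * ℓ)) k]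
    change e (RingClassField.inclusion ι hle (algebraMap K (ringClassField K ι c) k)) = _
    rw [he, d.emb_apply]
  · -- `hσ`
    intro l' hl' x x' hxx'
    change ((σ' l' x' : ringClassField K ι (c * ℓ)) : ℂ) = _
    simp only [σ', hl', if_true]
    rw [ha l' hl', ← SubgroupClass.coe_pow, ← hr ((g l') ^ a l') x x' hxx', map_pow]
  · -- `hS`
    intro s hs
    refine ⟨(lift s : ringClassField K ι (c * ℓ) ≃ₐ[ℚ] ringClassField K ι (c * ℓ)),
      Finset.mem_image.mpr ⟨s, hs, rfl⟩, fun x x' hxx' ↦ ?_⟩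
    rw [← hr (lift s) x x' hxx', hlift s (d.S_subset s hs)]
  · -- `hS'`
    intro s' hs'
    obtain ⟨s, hs, rfl⟩ := Finset.mem_image.mp hs'
    refine ⟨s, hs, fun x x' hxx' ↦ ?_⟩
    rw [← hr (lift s) x x' hxx', hlift s (d.S_subset s hs)]
  · -- `hemb`
    intro x x' hxx'
    rw [hincl x x' hxx']
    exact he x

/-- **The `dℓ` / `hdata` inputs of `JET.tamagawaExponent_le_mInfty_of_rowData`, DISCHARGED modulo the
CM fact `y(n) ∈ E(K[n])`** (Gross 1991 §3, `phi_heegnerPointOfConductor_mem_range_map_ringClassField`):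
for `E/ℚ` elliptic, `K` imaginary quadratic with `d_K < −4` and the Heegner hypothesis for `N`, a frame
`(Dt, β, ι)`, a square-free conductor `c` whose prime factors are Kolyvagin primes
(`Zhang2014.IsKolyvaginPrime`, any `p`) and ANY datum `d` of conductor `c`: there is a choice, for every
Kolyvagin prime `ℓ ∤ c`, of a datum of conductor `cℓ` compatible with `d` in the four clauses `hσ`,
`hS`, `hS'`, `hemb` of the row theorem (the level clause `k ≤ M(ℓ)` of `dℓ` is not needed for the
construction). [cite: GrossLMS1991, §3 (pp. 238–239), §4 (4.1)] [cite: McCallumLMS1991, §4 (p. 300)] -/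
theorem exists_compatible_data_of_grossCM [W.IsElliptic] [W.IsGloballyMinimal]
    (hCM : phi_heegnerPointOfConductor_mem_range_map_ringClassField N W K)
    (hK : IsImaginaryQuadratic K) (hD : NumberField.discr K < -4) (hH : SatisfiesHeegnerHypothesis N K)
    (p : ℕ) (Dt : ModularParametrizationData W N) (β : ℤ) (ι : K →+* ℂ)
    {c : ℕ} (hc : Squarefree c) (hcK : ∀ ℓ ∈ c.primeFactors, Zhang2014.IsKolyvaginPrime N W K p ℓ)
    (d : KolyvaginHeegnerData Dt β ι c) :
    ∃ dℓ : ∀ ℓ : ℕ, Zhang2014.IsKolyvaginPrime N W K p ℓ → ℓ ∉ c.primeFactors →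
        KolyvaginHeegnerData Dt β ι (c * ℓ),
      ∀ (ℓ : ℕ) (h1 : Zhang2014.IsKolyvaginPrime N W K p ℓ) (h3 : ℓ ∉ c.primeFactors),
        (∀ l' ∈ c.primeFactors, ∀ (x : ringClassField K ι c) (x' : ringClassField K ι (c * ℓ)),
          (x : ℂ) = x' → ((((dℓ ℓ h1 h3).σ l' x' : ringClassField K ι (c * ℓ)) : ℂ) = (d.σ l' x : ℂ))) ∧
        (∀ s ∈ d.S, ∃ s' ∈ (dℓ ℓ h1 h3).S, ∀ (x : ringClassField K ι c) (x' : ringClassField K ι (c * ℓ)),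
          (x : ℂ) = x' → ((s' x' : ringClassField K ι (c * ℓ)) : ℂ) = (s x : ℂ)) ∧
        (∀ s' ∈ (dℓ ℓ h1 h3).S, ∃ s ∈ d.S, ∀ (x : ringClassField K ι c) (x' : ringClassField K ι (c * ℓ)),
          (x : ℂ) = x' → ((s' x' : ringClassField K ι (c * ℓ)) : ℂ) = (s x : ℂ)) ∧
        (∀ (x : ringClassField K ι c) (x' : ringClassField K ι (c * ℓ)),
          (x : ℂ) = x' → (dℓ ℓ h1 h3).emb x' = d.emb x) := by
  have hc0 : c ≠ 0 := hc.ne_zero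
  have hex : ∀ (ℓ : ℕ), Zhang2014.IsKolyvaginPrime N W K p ℓ → ℓ ∉ c.primeFactors →
      ∃ d' : KolyvaginHeegnerData Dt β ι (c * ℓ),
        (∀ l' ∈ c.primeFactors, ∀ (x : ringClassField K ι c) (x' : ringClassField K ι (c * ℓ)),
          (x : ℂ) = x' → ((d'.σ l' x' : ringClassField K ι (c * ℓ)) : ℂ) = (d.σ l' x : ℂ)) ∧
        (∀ s ∈ d.S, ∃ s' ∈ d'.S, ∀ (x : ringClassField K ι c) (x' : ringClassField K ι (c * ℓ)),
          (x : ℂ) = x' → ((s' x' : ringClassField K ι (c * ℓ)) : ℂ) = (s x : ℂ)) ∧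
        (∀ s' ∈ d'.S, ∃ s ∈ d.S, ∀ (x : ringClassField K ι c) (x' : ringClassField K ι (c * ℓ)),
          (x : ℂ) = x' → ((s' x' : ringClassField K ι (c * ℓ)) : ℂ) = (s x : ℂ)) ∧
        (∀ (x : ringClassField K ι c) (x' : ringClassField K ι (c * ℓ)),
          (x : ℂ) = x' → d'.emb x' = d.emb x) := by
    intro ℓ h1 h3
    have hl : ℓ.Prime := h1.1
    have hlc : ¬ ℓ ∣ c := fun h ↦ h3 (Nat.mem_primeFactors.mpr ⟨hl, h, hc0⟩)
    have hcl : Squarefree (c * ℓ) :=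
      (Nat.squarefree_mul ((Nat.Prime.coprime_iff_not_dvd hl).mpr hlc).symm).mpr ⟨hc, hl.squarefree⟩
    have hinert : ∀ q ∈ (c * ℓ).primeFactors, (Ideal.span {(q : 𝓞 K)}).IsPrime := by
      intro q hq
      rw [Nat.primeFactors_mul hc0 hl.ne_zero, Finset.mem_union, hl.primeFactors,
        Finset.mem_singleton] at hq
      rcases hq with h | rfl
      · exact (hcK q h).2.2.2.2.1
      · exact h1.2.2.2.2.1
    obtain ⟨y', hy'⟩ := hCM hK hH Dt β ι (c * ℓ) d.dvd_sq_sub hcl.ne_zero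
      (BirchSwinnertonDyer.Theorems.coprime_of_primeFactors_inert hH hcl.ne_zero hinert)
    obtain ⟨d', -, hσ, hS, hS', hemb⟩ := exists_compatible_datum_mul hK hD ι Dt hcl hinert d y' hy'
    exact ⟨d', hσ, hS, hS', hemb⟩
  choose dℓ hσ hS hS' hemb using hex
  exact ⟨dℓ, fun ℓ h1 h3 ↦ ⟨hσ ℓ h1 h3, hS ℓ h1 h3, hS' ℓ h1 h3, hemb ℓ h1 h3⟩⟩

end Summit.BirchSwinnertonDyer.Rank1Residual.JET

end
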